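import Summits.BirchSwinnertonDyer.BirchSwinnertonDyer.Theorems.ManinLocalTwoThreeEtaQuotientsFourteen
import HarnessLib

/-!
# Level 15 (a ROOT for the twist families): the players of the weight-4 E₂ road on `X₀(15) = 15a1`

Cell bsd-f2-manin, route `ManinLocalTwoThree` (cruxes C2 `ManinOddAtFour` stmt-22967 / C3 `ManinPrimeToThreeAtNine` stmt-22968),
prover seat p3 gen 25; the level-`15` twin of `…EtaQuotientsFourteen`.  `X₀(15)` has genus one and is the optimal curve
`15a1 = [1, 1, 1, −10, −10]`; the level is SEMISTABLE, so it is a ROOT for the tree's fact-free twist engines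
(`twistLevelManinOne_of_levelManinOne`, `dyadicTwistLevelManinOne_of_levelManinOne`): once `LevelManinOne 15` is known
(sequel `…ManinConstantFifteen`), `2 ∤ c` and `3 ∤ c` follow on the ADDITIVE twist levels `240 = 16·15` (`15a ⊗ χ₋₄`), `960`,
`1920`, `15p²` (`p ≥ 7`), … with no printed fact.

THE DEVICE (weight-4 E₂ road, no `y`-coordinate).  On `15a1` the function `x + 1` is the single `η`-quotient
`𝓔 = η₃η₅⁵/(η₁η₁₅⁵)` (double pole at the cusp `∞`, double zero at the cusp `1/5` = the rational `2`-torsion point `(−1, 0)`),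
the newform is `φ₁₅ = η₁η₃η₅η₁₅` (tree `cuspFormEta15`), `(2y + x + 1)² = 4x³ + 5x² − 38x − 39 = 𝓔(4𝓔² − 7𝓔 − 36)` and
`𝓔′ = (πi/12)·G·𝓔` with `G = −E₂(τ) + 3E₂(3τ) + 25E₂(5τ) − 75E₂(15τ) ∈ M₂(Γ₀(15))`; the Weierstrass differential equation is
EQUIVALENT to **`G² = 2304·φ₁₅²𝓔 − 4032·φ₁₅² − 20736·φ₁₅²/𝓔` in `M₄(Γ₀(15))`** (all three `η`-quotients holomorphic at the four
cusps; Sturm bound `4·24/12 = 8`).  This file: the players and their `q`-remainders through `o(q⁹)`.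

* §1 `𝓔` is `Γ₀(15)`-invariant; `A = φ₁₅²𝓔 = η₁η₃³η₅⁷/η₁₅³`, `F = φ₁₅² = η₁²η₃²η₅²η₁₅²`, `C = φ₁₅²/𝓔 = η₁³η₃η₁₅⁷/η₅³` are in
  `M₄(Γ₀(15))`; `G ∈ M₂(Γ₀(15))`; `𝓔′ = (πi/12)G𝓔`;
* §2 the `η`-quotients as `q`-monomials times Euler functions;
* §3 `E₂(3τ)`, `E₂(5τ)`, `E₂(15τ)` and `E_3` through `o(q⁹)` (`E₂(τ)`, `E_1`, `E_5` are already in the tree at this depth).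

HONEST FRAMING: bookkeeping and `q`-series analysis; nothing here proves C2, C3, Manin's conjecture or BSD; items 22967/22968 stay
OPEN.  No definition, no named fact, no sorry. [cite: Ligozat1975, Ch. 3] [cite: Zagier2008, §2.3]
[cite: CremonaAlgorithms1997, §2.10 and Table 1 (15a1)]
-/

set_option autoImplicit false
-- lint-debt: the directory name repeats the summit name (sibling precedent `ManinLocalTwoThreeEtaQuotientsFourteen.lean`)
set_option linter.dupNamespace false

noncomputable section

open Complex Filter Topology Set Asymptotics Polynomial EisensteinSeries
open UpperHalfPlane hiding I
open scoped Real Topology Manifold MatrixGroups ModularForm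
open ModularForm CongruenceSubgroup
open Literature.NumberTheory.ModularForms
open Literature.NumberTheory.EllipticCurves Literature.NumberTheory.EllipticCurves.ModularForms

namespace Summit.BirchSwinnertonDyer.BirchSwinnertonDyer.Theorems.ManinLocalTwoThree.EtaQuotientsFifteen

open QRemainder EulerRemainders EtaLogDerivativeForms
open EulerRemaindersSixtyFour (cexp_eq_qParam_pow)

/-! ## §1 The players: `𝓔`, `A`, `F`, `C`, `G` -/

/-- The divisors of `15`. [folklore] -/
theorem divisors_fifteen : Nat.divisors 15 = {1, 3, 5, 15} := by decide

/-- Newman's conditions for `𝓔 = η₃η₅⁵/(η₁η₁₅⁵)` (`= x + 1` on `15a1`) in weight `0` (`∏ δ^{|r_δ|} = 3⁶5¹⁰ = 84375²`).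
[cite: Ligozat1975, Ch. 3] -/
theorem newmanCond_E : NewmanCond 15 (expFn [(1, -1), (3, 1), (5, 5), (15, -5)]) 0 :=
  ⟨by decide, by decide, by decide, ⟨84375, by decide⟩⟩

/-- **`𝓔(γτ) = 𝓔(τ)` for `γ ∈ Γ₀(15)`.** [cite: Ligozat1975, Ch. 3] -/
theorem E_smul (γ : Gamma0 15) (τ : ℍ) :
    etaQuotient 15 (expFn [(1, -1), (3, 1), (5, 5), (15, -5)]) ((γ : SL(2, ℤ)) • τ)
      = etaQuotient 15 (expFn [(1, -1), (3, 1), (5, 5), (15, -5)]) τ := by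
  simpa using etaQuotient_smul_of_mem_Gamma0 15 (by norm_num) (expFn [(1, -1), (3, 1), (5, 5), (15, -5)]) 0
    Even.zero newmanCond_E γ.2 τ

/-- Newman's conditions for `A = φ₁₅²𝓔 = η₁η₃³η₅⁷/η₁₅³` in weight `4` (`∏ δ^{|r_δ|} = 84375²`). [cite: Ligozat1975, Ch. 3] -/
theorem newmanCond_A : NewmanCond 15 (expFn [(1, 1), (3, 3), (5, 7), (15, -3)]) 4 :=
  ⟨by decide, by decide, by decide, ⟨84375, by decide⟩⟩

/-- Ligozat's orders of `A` at the four cusps are `≥ 0` (`48, 144, 480, 0` in units of `1/24`). [cite: Ligozat1975, Ch. 3] -/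
theorem cuspOrder24_nonneg_A :
    ∀ t ∈ (15 : ℕ).divisors, 0 ≤ cuspOrder24 15 (expFn [(1, 1), (3, 3), (5, 7), (15, -3)]) t := by
  decide

/-- **`A ∈ M₄(Γ₀(15))`.** [cite: Ligozat1975, Ch. 3] -/
theorem exists_modularForm_A :
    ∃ F : ModularForm (Gamma0 15) 4, ⇑F = etaQuotient 15 (expFn [(1, 1), (3, 3), (5, 7), (15, -3)]) :=
  ⟨etaQuotientModularForm 15 _ 4 (by decide) newmanCond_A cuspOrder24_nonneg_A, rfl⟩

/-- Newman's conditions for `F = φ₁₅² = η₁²η₃²η₅²η₁₅²` in weight `4` (`∏ δ^{|r_δ|} = 225²`). [cite: Ligozat1975, Ch. 3] -/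
theorem newmanCond_F : NewmanCond 15 (expFn [(1, 2), (3, 2), (5, 2), (15, 2)]) 4 :=
  ⟨by decide, by decide, by decide, ⟨225, by decide⟩⟩

/-- Ligozat's orders of `F` at the four cusps are `≥ 0` (indeed `48` each). [cite: Ligozat1975, Ch. 3] -/
theorem cuspOrder24_nonneg_F :
    ∀ t ∈ (15 : ℕ).divisors, 0 ≤ cuspOrder24 15 (expFn [(1, 2), (3, 2), (5, 2), (15, 2)]) t := by
  decide

/-- **`F ∈ M₄(Γ₀(15))`.** [cite: Ligozat1975, Ch. 3] -/
theorem exists_modularForm_F :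
    ∃ F : ModularForm (Gamma0 15) 4, ⇑F = etaQuotient 15 (expFn [(1, 2), (3, 2), (5, 2), (15, 2)]) :=
  ⟨etaQuotientModularForm 15 _ 4 (by decide) newmanCond_F cuspOrder24_nonneg_F, rfl⟩

/-- Newman's conditions for `C = φ₁₅²/𝓔 = η₁³η₃η₁₅⁷/η₅³` in weight `4` (`∏ δ^{|r_δ|} = 3⁸5¹⁰ = 253125²`). [cite: Ligozat1975, Ch. 3] -/
theorem newmanCond_C : NewmanCond 15 (expFn [(1, 3), (3, 1), (5, -3), (15, 7)]) 4 :=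
  ⟨by decide, by decide, by decide, ⟨253125, by decide⟩⟩

/-- Ligozat's orders of `C` at the four cusps are `≥ 0` (`48, 144, 0, 1440`). [cite: Ligozat1975, Ch. 3] -/
theorem cuspOrder24_nonneg_C :
    ∀ t ∈ (15 : ℕ).divisors, 0 ≤ cuspOrder24 15 (expFn [(1, 3), (3, 1), (5, -3), (15, 7)]) t := by
  decide

/-- **`C ∈ M₄(Γ₀(15))`.** [cite: Ligozat1975, Ch. 3] -/
theorem exists_modularForm_C :
    ∃ F : ModularForm (Gamma0 15) 4, ⇑F = etaQuotient 15 (expFn [(1, 3), (3, 1), (5, -3), (15, 7)]) :=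
  ⟨etaQuotientModularForm 15 _ 4 (by decide) newmanCond_C cuspOrder24_nonneg_C, rfl⟩

/-- `Σ_{δ∣15} r_δ(𝓔) = 0` read in `ℂ`. [folklore] -/
theorem sum_expFn_E_cast :
    ∑ δ ∈ (15 : ℕ).divisors, ((expFn [(1, -1), (3, 1), (5, 5), (15, -5)] δ : ℤ) : ℂ) = 0 := by
  rw [← Int.cast_sum, show (∑ δ ∈ (15 : ℕ).divisors, expFn [(1, -1), (3, 1), (5, 5), (15, -5)] δ) = 0 by decide,
    Int.cast_zero]

/-- `G = Σ_δ r_δ(𝓔)·δ·E₂(δτ) = −E₂(τ) + 3E₂(3τ) + 25E₂(5τ) − 75E₂(15τ)` spelled out. [cite: Zagier2008, §2.3] -/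
theorem e2Comb_E_eq (τ : ℍ) :
    (∑ δ ∈ (15 : ℕ).divisors, ((expFn [(1, -1), (3, 1), (5, 5), (15, -5)] δ : ℤ) : ℂ) * (δ : ℂ) * E2 (sixMulPt δ τ))
      = -E2 (sixMulPt 1 τ) + 3 * E2 (sixMulPt 3 τ) + 25 * E2 (sixMulPt 5 τ) - 75 * E2 (sixMulPt 15 τ) := by
  rw [divisors_fifteen, Finset.sum_insert (by decide), Finset.sum_insert (by decide), Finset.sum_insert (by decide),
    Finset.sum_singleton]
  rw [show expFn [(1, -1), (3, 1), (5, 5), (15, -5)] 1 = (-1) by decide,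
    show expFn [(1, -1), (3, 1), (5, 5), (15, -5)] 3 = 1 by decide,
    show expFn [(1, -1), (3, 1), (5, 5), (15, -5)] 5 = 5 by decide,
    show expFn [(1, -1), (3, 1), (5, 5), (15, -5)] 15 = (-5) by decide]
  push_cast
  ring

/-- **`G = −E₂(τ) + 3E₂(3τ) + 25E₂(5τ) − 75E₂(15τ) ∈ M₂(Γ₀(15))`** (`Σ r_δ = 0`). [cite: DiamondShurman2005, §1.2] -/
theorem exists_modularForm_G : ∃ G : ModularForm (Gamma0 15) 2, ∀ τ : ℍ,
    G τ = -E2 (sixMulPt 1 τ) + 3 * E2 (sixMulPt 3 τ) + 25 * E2 (sixMulPt 5 τ) - 75 * E2 (sixMulPt 15 τ) := by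
  obtain ⟨G, hG⟩ := exists_modularForm_e2Comb 15 (fun δ ↦ ((expFn [(1, -1), (3, 1), (5, 5), (15, -5)] δ : ℤ) : ℂ))
    sum_expFn_E_cast
  exact ⟨G, fun τ ↦ (hG τ).trans (e2Comb_E_eq τ)⟩

/-- **`𝓔′ = (πi/12)·G·𝓔` on `ℍ`.** [cite: Zagier2008, §2.3] -/
theorem deriv_E (τ : ℍ) :
    deriv (etaQuotient 15 (expFn [(1, -1), (3, 1), (5, 5), (15, -5)]) ∘ ofComplex) τ
      = (π * I / 12) * (-E2 (sixMulPt 1 τ) + 3 * E2 (sixMulPt 3 τ) + 25 * E2 (sixMulPt 5 τ) - 75 * E2 (sixMulPt 15 τ))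
        * etaQuotient 15 (expFn [(1, -1), (3, 1), (5, 5), (15, -5)]) τ := by
  rw [deriv_etaQuotient_eq_e2Comb 15 _ τ, e2Comb_E_eq τ]

/-! ## §2 The `η`-quotients as `q`-monomials times Euler functions -/

/-- **`𝓔 = η₃η₅⁵/(η₁η₁₅⁵) = E₃E₅⁵/(q²E₁E₁₅⁵)`.** [folklore] -/
theorem E_eq (τ : ℍ) :
    etaQuotient 15 (expFn [(1, -1), (3, 1), (5, 5), (15, -5)]) τ
      = eulerFn 3 τ * eulerFn 5 τ ^ 5 / (Function.Periodic.qParam 1 (τ : ℂ) ^ 2 * eulerFn 1 τ * eulerFn 15 τ ^ 5) := by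
  have hE1 := eulerFn_ne_zero (by norm_num : 0 < 1) τ
  have hE15 := eulerFn_ne_zero (by norm_num : 0 < 15) τ
  have hq := qParam_ne_zero τ
  rw [etaQuotient_eq_cexp_mul_prod, divisors_fifteen]
  have hsum : (∑ δ ∈ ({1, 3, 5, 15} : Finset ℕ),
      (δ : ℤ) * expFn [(1, -1), (3, 1), (5, 5), (15, -5)] δ) = (-(24 * 2 : ℕ) : ℤ) := by decide
  rw [hsum, cexp_neg_eq_inv_qParam_pow]
  rw [Finset.prod_insert (by decide), Finset.prod_insert (by decide), Finset.prod_insert (by decide),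
    Finset.prod_singleton]
  rw [show expFn [(1, -1), (3, 1), (5, 5), (15, -5)] 1 = (-1) by decide,
    show expFn [(1, -1), (3, 1), (5, 5), (15, -5)] 3 = 1 by decide,
    show expFn [(1, -1), (3, 1), (5, 5), (15, -5)] 5 = 5 by decide,
    show expFn [(1, -1), (3, 1), (5, 5), (15, -5)] 15 = (-5) by decide]
  simp only [zpow_neg, zpow_ofNat]
  field_simp

/-- **`A = η₁η₃³η₅⁷/η₁₅³ = E₁E₃³E₅⁷/E₁₅³`** (no `q`-power: `Σ δ r_δ = 0`). [folklore] -/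
theorem A_eq (τ : ℍ) :
    etaQuotient 15 (expFn [(1, 1), (3, 3), (5, 7), (15, -3)]) τ
      = eulerFn 1 τ * eulerFn 3 τ ^ 3 * eulerFn 5 τ ^ 7 / eulerFn 15 τ ^ 3 := by
  have hE15 := eulerFn_ne_zero (by norm_num : 0 < 15) τ
  rw [etaQuotient_eq_cexp_mul_prod, divisors_fifteen]
  have hsum : (∑ δ ∈ ({1, 3, 5, 15} : Finset ℕ),
      (δ : ℤ) * expFn [(1, 1), (3, 3), (5, 7), (15, -3)] δ) = ((24 * 0 : ℕ) : ℤ) := by decide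
  rw [hsum, cexp_eq_qParam_pow, pow_zero, one_mul]
  rw [Finset.prod_insert (by decide), Finset.prod_insert (by decide), Finset.prod_insert (by decide),
    Finset.prod_singleton]
  rw [show expFn [(1, 1), (3, 3), (5, 7), (15, -3)] 1 = 1 by decide,
    show expFn [(1, 1), (3, 3), (5, 7), (15, -3)] 3 = 3 by decide,
    show expFn [(1, 1), (3, 3), (5, 7), (15, -3)] 5 = 7 by decide,
    show expFn [(1, 1), (3, 3), (5, 7), (15, -3)] 15 = (-3) by decide]
  simp only [zpow_neg, zpow_ofNat]
  field_simp

/-- **`F = φ₁₅² = η₁²η₃²η₅²η₁₅² = q²E₁²E₃²E₅²E₁₅²`.** [folklore] -/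
theorem F_eq (τ : ℍ) :
    etaQuotient 15 (expFn [(1, 2), (3, 2), (5, 2), (15, 2)]) τ
      = Function.Periodic.qParam 1 (τ : ℂ) ^ 2 * eulerFn 1 τ ^ 2 * eulerFn 3 τ ^ 2 * eulerFn 5 τ ^ 2 * eulerFn 15 τ ^ 2 := by
  rw [etaQuotient_eq_cexp_mul_prod, divisors_fifteen]
  have hsum : (∑ δ ∈ ({1, 3, 5, 15} : Finset ℕ),
      (δ : ℤ) * expFn [(1, 2), (3, 2), (5, 2), (15, 2)] δ) = ((24 * 2 : ℕ) : ℤ) := by decide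
  rw [hsum, cexp_eq_qParam_pow]
  rw [Finset.prod_insert (by decide), Finset.prod_insert (by decide), Finset.prod_insert (by decide),
    Finset.prod_singleton]
  rw [show expFn [(1, 2), (3, 2), (5, 2), (15, 2)] 1 = 2 by decide,
    show expFn [(1, 2), (3, 2), (5, 2), (15, 2)] 3 = 2 by decide,
    show expFn [(1, 2), (3, 2), (5, 2), (15, 2)] 5 = 2 by decide,
    show expFn [(1, 2), (3, 2), (5, 2), (15, 2)] 15 = 2 by decide]
  simp only [zpow_ofNat]
  ring

/-- **`C = η₁³η₃η₁₅⁷/η₅³ = q⁴E₁³E₃E₁₅⁷/E₅³`.** [folklore] -/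
theorem C_eq (τ : ℍ) :
    etaQuotient 15 (expFn [(1, 3), (3, 1), (5, -3), (15, 7)]) τ
      = Function.Periodic.qParam 1 (τ : ℂ) ^ 4 * eulerFn 1 τ ^ 3 * eulerFn 3 τ * eulerFn 15 τ ^ 7 / eulerFn 5 τ ^ 3 := by
  have hE5 := eulerFn_ne_zero (by norm_num : 0 < 5) τ
  rw [etaQuotient_eq_cexp_mul_prod, divisors_fifteen]
  have hsum : (∑ δ ∈ ({1, 3, 5, 15} : Finset ℕ),
      (δ : ℤ) * expFn [(1, 3), (3, 1), (5, -3), (15, 7)] δ) = ((24 * 4 : ℕ) : ℤ) := by decide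
  rw [hsum, cexp_eq_qParam_pow]
  rw [Finset.prod_insert (by decide), Finset.prod_insert (by decide), Finset.prod_insert (by decide),
    Finset.prod_singleton]
  rw [show expFn [(1, 3), (3, 1), (5, -3), (15, 7)] 1 = 3 by decide,
    show expFn [(1, 3), (3, 1), (5, -3), (15, 7)] 3 = 1 by decide,
    show expFn [(1, 3), (3, 1), (5, -3), (15, 7)] 5 = (-3) by decide,
    show expFn [(1, 3), (3, 1), (5, -3), (15, 7)] 15 = 7 by decide]
  simp only [zpow_neg, zpow_ofNat]
  field_simp

/-! ## §3 `E₂(3τ)`, `E₂(5τ)`, `E₂(15τ)` and `E_3` through `o(q⁹)` -/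

/-- **`E₂(3τ) = 1 − 24q³ − 72q⁶ − 96q⁹ + o(q⁹)`.** [cite: Zagier2008, §2.3] -/
theorem tendsto_E2_three_nine :
    Tendsto (fun τ : ℍ ↦ (E2 (sixMulPt 3 τ) - (1 - 24 * X ^ 3 - 72 * X ^ 6 - 96 * X ^ 9 : ℂ[X]).eval
      (Function.Periodic.qParam 1 (τ : ℂ))) / Function.Periodic.qParam 1 (τ : ℂ) ^ 9) atImInfty (𝓝 0) := by
  refine congr_poly ?_ (tendsto_E2_sixMulPt (by norm_num : 0 < 3) 9)
  obtain ⟨s1, s2, s3, s4, s5, s6, s7, s8, s9⟩ := EtaQuotientsFourteen.sigma_one_le_nine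
  simp only [Finset.sum_range_succ, Finset.sum_range_zero, e2NatMulCoeff_eq _ _ (by norm_num : 0 < 3)]
  norm_num [s1, s2, s3, s4, s5, s6, s7, s8, s9]
  simp only [map_ofNat]
  ring

/-- **`E₂(5τ) = 1 − 24q⁵ + o(q⁹)`.** [cite: Zagier2008, §2.3] -/
theorem tendsto_E2_five_nine :
    Tendsto (fun τ : ℍ ↦ (E2 (sixMulPt 5 τ) - (1 - 24 * X ^ 5 : ℂ[X]).eval (Function.Periodic.qParam 1 (τ : ℂ)))
      / Function.Periodic.qParam 1 (τ : ℂ) ^ 9) atImInfty (𝓝 0) := by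
  refine congr_poly ?_ (tendsto_E2_sixMulPt (by norm_num : 0 < 5) 9)
  obtain ⟨s1, s2, s3, s4, s5, s6, s7, s8, s9⟩ := EtaQuotientsFourteen.sigma_one_le_nine
  simp only [Finset.sum_range_succ, Finset.sum_range_zero, e2NatMulCoeff_eq _ _ (by norm_num : 0 < 5)]
  norm_num [s1, s2, s3, s4, s5, s6, s7, s8, s9]
  simp only [map_ofNat]
  ring

/-- **`E₂(15τ) = 1 + o(q⁹)`.** [cite: Zagier2008, §2.3] -/
theorem tendsto_E2_fifteen_nine :
    Tendsto (fun τ : ℍ ↦ (E2 (sixMulPt 15 τ) - (1 : ℂ[X]).eval (Function.Periodic.qParam 1 (τ : ℂ)))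
      / Function.Periodic.qParam 1 (τ : ℂ) ^ 9) atImInfty (𝓝 0) := by
  refine congr_poly ?_ (tendsto_E2_sixMulPt (by norm_num : 0 < 15) 9)
  simp only [Finset.sum_range_succ, Finset.sum_range_zero, e2NatMulCoeff_eq _ _ (by norm_num : 0 < 15)]
  norm_num

/-- The `q`-coefficients `0, …, 9` of `E_3 = ∏(1 − q^{3n})`: `1` at `0`, `−1` at `3` and `6`, else `0`. [folklore] -/
theorem coeff_formalEulerScaled_three_le_nine (n : ℕ) (hn : n ≤ 9) :
    PowerSeries.coeff n (formalEulerScaled 3) = if n = 0 then 1 else if n = 3 then -1 else if n = 6 then -1 else 0 := by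
  have h := EulerRemaindersForty.coeff_formalEulerPow_one_le_nine
  interval_cases n <;> simp +decide [coeff_formalEulerScaled, h]

/-- **`E_3 = 1 − q³ − q⁶ + o(q⁹)`.** [folklore] -/
theorem tendsto_eulerFn_three_nine :
    Tendsto (fun τ : ℍ ↦ (eulerFn 3 τ - (1 - X ^ 3 - X ^ 6 : ℂ[X]).eval (Function.Periodic.qParam 1 (τ : ℂ)))
      / Function.Periodic.qParam 1 (τ : ℂ) ^ 9) atImInfty (𝓝 0) := by
  refine congr_poly ?_ (tendsto_of_hasSum (periodic_eulerFn 3) (mdifferentiable_eulerFn 3)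
    (isBoundedAtImInfty_eulerFn (by norm_num)) (hasSum_eulerFn (by norm_num)) 9)
  have h := coeff_formalEulerScaled_three_le_nine
  simp only [Finset.sum_range_succ, Finset.sum_range_zero, h 0 (by norm_num), h 1 (by norm_num),
    h 2 (by norm_num), h 3 (by norm_num), h 4 (by norm_num), h 5 (by norm_num), h 6 (by norm_num),
    h 7 (by norm_num), h 8 (by norm_num), h 9 (by norm_num)]
  norm_num
  ring

end Summit.BirchSwinnertonDyer.BirchSwinnertonDyer.Theorems.ManinLocalTwoThree.EtaQuotientsFifteen

end
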